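import Literature.NumberTheory.LFunctions.StarkExceptionalZeroProofs
import Literature.Analysis.SpecialFunctions.DigammaGauss
import Literature.Analysis.SpecialFunctions.EulerMascheroniBounds
import Mathlib.NumberTheory.ZetaValues
import HarnessLib

/-!
# Stark's analytic lower bound for the discriminant of a number field

Topic `Literature/NumberTheory/LFunctions` (namespace `Literature.NumberTheory.LFunctions.NumberField`).
Everything in this file is PROVED (no named fact, no definition).

Let `K` be a number field of degree `n = r₁ + 2r₂` and discriminant `d_K`, and let `ψ = Γ'/Γ`.
Stark [Stark1975] used the functional equation and Hadamard's factorisation of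
`ξ_K(s) = s(s−1)|d_K|^{s/2}Γ_ℝ(s)^{r₁}Γ_ℂ(s)^{r₂}ζ_K(s)` to bound `|d_K|` from below; in the form of
[Bordelles2020ArithmeticTales, Prop. 7.32]: for every real `σ > 1`,

  `log|d_K| ≥ r₁(log π − ψ(σ/2)) + 2r₂(log 2π − ψ(σ)) − 2/σ − 2/(σ−1)`,

the two dropped terms `2·(−ζ_K'/ζ_K)(σ) = 2 Σ_𝔞 Λ(𝔞)N𝔞^{−σ} > 0` and `Σ_ρ 2 Re 1/(σ−ρ) > 0` being
non-negative (displayed identity in the proof of Prop. 7.32).  Consequences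
[Bordelles2020ArithmeticTales, Cor. 7.9]: `|d_K| > e^{−8}(2π)^n` for `n ≥ 2` and `|d_K| > (2π)^n`
for `n ≥ 50` — bounds that eventually supersede Minkowski's geometric bound.

Contents:
* §1 the digamma inputs: `ψ(x) − ψ(x₀) ≤ (x − x₀) Σ_k (k+x₀)^{−2}` for real `0 < x₀ ≤ x`
  (termwise from `ψ(w) + γ = Σ_k (1/(k+1) − 1/(w+k))`), `Σ_k (k+1)^{−2} = π²/6`,
  `Σ_k (2k+1)^{−2} = π²/8`, hence `ψ((1+h)/2) ≤ −γ − 2 log 2 + (π²/4)h` and `ψ(1+h) ≤ −γ + (π²/6)h`;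
* §2 `re_logDeriv_xi_eq` — the real-axis decomposition
  `Re ξ_K'/ξ_K(σ) = 1/σ + 1/(σ−1) − L(Λ_K,σ) + ½log|d_K| + r₁ Re Γ_ℝ'/Γ_ℝ(σ) + r₂ Re Γ_ℂ'/Γ_ℂ(σ)`
  with `Γ_ℝ'/Γ_ℝ(σ) = −½log π + ½ψ(σ/2)`, `Γ_ℂ'/Γ_ℂ(σ) = −log 2π + ψ(σ)`;
* §3 **Prop. 7.32 with the prime and zero terms kept** (`log_absdiscr_ge_of_zeros`: for any finite
  multiset `S` of zeros of `ζ_K` in `Re s > 0`, counted at most with multiplicity,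
  `r₁(log π − ψ(σ/2)) + 2r₂(log 2π − ψ(σ)) − 2/σ − 2/(σ−1) + 2L(Λ_K,σ) + 2Σ_{ρ∈S} Re 1/(σ−ρ) ≤ log|d_K|`),
  **Prop. 7.32** (`log_absdiscr_ge_stark`), and the tangent-line form
  `log|d_K| ≥ r₁(log 4π + γ − (π²/4)h) + 2r₂(log 2π + γ − (π²/6)h) − 2/h − 2/(1+h)` (`0 < h`);
* §4 **Cor. 7.9**: `log|d_K| ≥ n(log 2π + γ) − 2√(π²n/3) − 2` (`n ≥ 2`), `|d_K| > e^{−8}(2π)^n`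
  (`n ≥ 2`), `|d_K| > (2π)^n` (`n ≥ 50`).

The proof of Cor. 7.9 here replaces Gautschi's inequality by the tangent-line bounds of §1 (which
are sharper as `h → 0`); the printed constants `e^{−8}` and `50` are recovered.

## References

* O. Bordellès, *Arithmetic Tales. Advanced Edition*, Universitext, Springer 2020, Prop. 7.32 and
  Cor. 7.9 (held text, ch. 7 §7.4.8 "Lower bounds for |d_K|"). [Bordelles2020ArithmeticTales]
* H. M. Stark, *Some effective cases of the Brauer–Siegel theorem*, Invent. Math. 23 (1974)
  135–152, §2. [Stark1974]
* H. M. Stark, *The analytic theory of algebraic numbers*, Bull. Amer. Math. Soc. 81 (1975)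
  961–972. [Stark1975]
-/

noncomputable section

open scoped NumberField
open Complex Filter Topology Set NumberField NumberField.InfinitePlace

namespace Literature.NumberTheory.LFunctions.NumberField

/-! ## §1 Digamma inputs on the real axis -/

section Digamma

open Literature.Analysis.SpecialFunctions.Complex (hasSum_one_div_sub_one_div_digamma)

/-- The series `ψ(x) + γ = Σ_k (1/(k+1) − 1/(x+k))` for real `x > 0`, real parts.
[cite: AndrewsAskeyRoy1999, Thm 1.2.5 (1.2.13)] -/
theorem hasSum_re_digamma_ofReal {x : ℝ} (hx : 0 < x) :
    HasSum (fun k : ℕ ↦ 1 / ((k : ℝ) + 1) - 1 / (x + k))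
      ((digamma (x : ℂ)).re + Real.eulerMascheroniConstant) := by
  have h := (hasSum_one_div_sub_one_div_digamma (w := (x : ℂ)) (by simpa using hx)).mapL reCLM
  simp only [reCLM_apply, add_re, ofReal_re] at h
  refine h.congr_fun fun k ↦ ?_
  rw [sub_re, show ((k : ℂ) + 1) = (((k : ℝ) + 1 : ℝ) : ℂ) by push_cast; ring,
    show ((x : ℂ) + k) = ((x + k : ℝ) : ℂ) by push_cast; ring, div_ofReal_re, div_ofReal_re, one_re]

/-- **Tangent-line bound for `ψ` on the real axis**: for `0 < x₀ ≤ x` and `Σ_k (k+x₀)^{−2} = T`,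
`ψ(x) − ψ(x₀) ≤ (x − x₀)·T` (termwise: `1/(k+x₀) − 1/(k+x) = (x−x₀)/((k+x₀)(k+x)) ≤ (x−x₀)/(k+x₀)²`;
this is `ψ(x) ≤ ψ(x₀) + (x−x₀)ψ'(x₀)`, `ψ'(x₀) = Σ_k (k+x₀)^{−2}` being decreasing in `x₀`).
[cite: AndrewsAskeyRoy1999, Thm 1.2.5 (1.2.13)–(1.2.14)] -/
theorem re_digamma_ofReal_sub_le {x₀ x T : ℝ} (hx₀ : 0 < x₀) (hx : x₀ ≤ x)
    (hT : HasSum (fun k : ℕ ↦ 1 / ((k : ℝ) + x₀) ^ 2) T) :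
    (digamma (x : ℂ)).re - (digamma (x₀ : ℂ)).re ≤ (x - x₀) * T := by
  have hxpos : 0 < x := lt_of_lt_of_le hx₀ hx
  have h₀ := hasSum_re_digamma_ofReal hx₀
  have h₁ := hasSum_re_digamma_ofReal hxpos
  -- `Σ_k (1/(x₀+k) − 1/(x+k)) = ψ(x) − ψ(x₀)`
  have hdiff : HasSum (fun k : ℕ ↦ 1 / (x₀ + k) - 1 / (x + k))
      ((digamma (x : ℂ)).re + Real.eulerMascheroniConstant -
        ((digamma (x₀ : ℂ)).re + Real.eulerMascheroniConstant)) := by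
    refine (h₁.sub h₀).congr_fun fun k ↦ ?_
    ring
  have hmaj : HasSum (fun k : ℕ ↦ (x - x₀) * (1 / ((k : ℝ) + x₀) ^ 2)) ((x - x₀) * T) :=
    hT.mul_left _
  have hle : ∀ k : ℕ, 1 / (x₀ + k) - 1 / (x + k) ≤ (x - x₀) * (1 / ((k : ℝ) + x₀) ^ 2) := by
    intro k
    have ha : 0 < x₀ + k := by positivity
    have hb : 0 < x + k := by positivity
    rw [div_sub_div _ _ ha.ne' hb.ne', show (1 * (x + k) - (x₀ + k) * 1) = x - x₀ by ring,
      show (x - x₀) * (1 / ((k : ℝ) + x₀) ^ 2) = (x - x₀) / ((x₀ + k) * (x₀ + k)) by ring]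
    exact div_le_div_of_nonneg_left (by linarith) (mul_pos ha ha)
      (mul_le_mul_of_nonneg_left (by linarith) ha.le)
  have := hasSum_le hle hdiff hmaj
  linarith

/-- `Σ_{k ≥ 0} (k+1)^{−2} = π²/6`. [folklore] -/
private theorem hasSum_inv_nat_add_one_sq :
    HasSum (fun k : ℕ ↦ 1 / ((k : ℝ) + 1) ^ 2) (Real.pi ^ 2 / 6) := by
  have h := (hasSum_nat_add_iff' (f := fun n : ℕ ↦ (1 : ℝ) / (n : ℝ) ^ 2) 1).mpr hasSum_zeta_two
  simp only [Finset.sum_range_one, Nat.cast_zero, ne_eq, OfNat.ofNat_ne_zero, not_false_eq_true,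
    zero_pow, div_zero, sub_zero, Nat.cast_add, Nat.cast_one] at h
  exact h

/-- `Σ_{k ≥ 0} (2k+1)^{−2} = π²/8` (odd part of `ζ(2) = π²/6`). [folklore] -/
private theorem hasSum_inv_odd_sq :
    HasSum (fun k : ℕ ↦ 1 / (2 * (k : ℝ) + 1) ^ 2) (Real.pi ^ 2 / 8) := by
  set f : ℕ → ℝ := fun n ↦ 1 / (n : ℝ) ^ 2 with hf
  have h : HasSum f (Real.pi ^ 2 / 6) := hasSum_zeta_two
  -- even part `Σ f(2k) = π²/24`
  have he : HasSum (fun k : ℕ ↦ f (2 * k)) (Real.pi ^ 2 / 24) := by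
    rw [show Real.pi ^ 2 / 24 = 1 / 4 * (Real.pi ^ 2 / 6) by ring]
    exact (h.mul_left (1 / 4)).congr_fun fun k ↦ by simp only [hf]; push_cast; ring
  -- odd part
  have hinj : Function.Injective (fun k : ℕ ↦ 2 * k + 1) := fun a b hab ↦ by
    simpa using hab
  obtain ⟨x, hx⟩ := h.summable.comp_injective hinj
  have hx' : HasSum (fun k : ℕ ↦ f (2 * k + 1)) x := hx
  have htot : HasSum f (Real.pi ^ 2 / 24 + x) := he.even_add_odd hx'
  have hxval : x = Real.pi ^ 2 / 8 := by
    have := htot.unique h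
    linarith
  rw [← hxval]
  refine hx'.congr_fun fun k ↦ ?_
  simp only [hf]
  push_cast
  ring

/-- `Σ_{k ≥ 0} (k+½)^{−2} = π²/2` (`= ψ'(½)`). [folklore] -/
private theorem hasSum_inv_nat_add_half_sq :
    HasSum (fun k : ℕ ↦ 1 / ((k : ℝ) + 1 / 2) ^ 2) (Real.pi ^ 2 / 2) := by
  rw [show Real.pi ^ 2 / 2 = 4 * (Real.pi ^ 2 / 8) by ring]
  refine (hasSum_inv_odd_sq.mul_left 4).congr_fun fun k ↦ ?_
  have hk : (2 * (k : ℝ) + 1) ≠ 0 := by positivity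
  have hk' : ((k : ℝ) + 1 / 2) ≠ 0 := by positivity
  field_simp
  ring

/-- **`ψ((1+h)/2) ≤ −γ − 2 log 2 + (π²/4) h`** for `h ≥ 0` (tangent line at `½`:
`ψ(½) = −γ − 2 log 2`, `ψ'(½) = π²/2`). [folklore] -/
private theorem re_digamma_half_add_le {h : ℝ} (hh : 0 ≤ h) :
    (digamma ((((1 + h) / 2 : ℝ)) : ℂ)).re ≤
      -Real.eulerMascheroniConstant - 2 * Real.log 2 + Real.pi ^ 2 / 4 * h := by
  have h1 := re_digamma_ofReal_sub_le (x₀ := 1 / 2) (x := (1 + h) / 2) (by norm_num) (by linarith)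
    hasSum_inv_nat_add_half_sq
  have hhalf : (digamma (((1 / 2 : ℝ)) : ℂ)).re = -2 * Real.log 2 - Real.eulerMascheroniConstant := by
    have e : digamma (((1 / 2 : ℝ)) : ℂ) =
        (((-2 * Real.log 2 - Real.eulerMascheroniConstant : ℝ)) : ℂ) := by
      rw [show (((1 / 2 : ℝ)) : ℂ) = 1 / 2 by push_cast; ring, Complex.digamma_one_half]
      push_cast
      simp only [Complex.ofNat_log]
    rw [e, ofReal_re]
  rw [hhalf] at h1
  nlinarith [Real.pi_pos]

/-- **`ψ(1+h) ≤ −γ + (π²/6) h`** for `h ≥ 0` (tangent line at `1`: `ψ(1) = −γ`, `ψ'(1) = π²/6`).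
[folklore] -/
private theorem re_digamma_one_add_le {h : ℝ} (hh : 0 ≤ h) :
    (digamma (((1 + h : ℝ)) : ℂ)).re ≤ -Real.eulerMascheroniConstant + Real.pi ^ 2 / 6 * h := by
  have h1 := re_digamma_ofReal_sub_le (x₀ := 1) (x := 1 + h) one_pos (by linarith)
    hasSum_inv_nat_add_one_sq
  have hone : (digamma (((1 : ℝ)) : ℂ)).re = -Real.eulerMascheroniConstant := by
    rw [ofReal_one, Complex.digamma_one]
    simp
  rw [hone] at h1
  nlinarith [Real.pi_pos]

end Digamma

/-! ## §2 The logarithmic derivative of `ξ_K` on the real axis -/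

variable {K : Type*} [Field K] [NumberField K]

omit [NumberField K] in
/-- `Re Γ_ℝ'/Γ_ℝ(σ) = −½ log π + ½ ψ(σ/2)` for real `σ > 0` (the gamma-factor terms of the
displayed identity in the proof of Prop. 7.32). [cite: Bordelles2020ArithmeticTales, Prop. 7.32 (proof)] -/
theorem re_logDeriv_Gammaℝ_ofReal {σ : ℝ} (hσ : 0 < σ) :
    (logDeriv Gammaℝ σ).re = -Real.log Real.pi / 2 + (digamma ((σ : ℂ) / 2)).re / 2 := by
  have hs : ∀ m : ℕ, (σ : ℂ) / 2 ≠ -m := fun m h ↦ by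
    have := congrArg Complex.re h
    simp at this
    have hm : (0 : ℝ) ≤ m := m.cast_nonneg
    linarith
  rw [LFunctions.logDeriv_Gammaℝ hs, add_re, div_ofNat_re, neg_re, log_ofReal_re, div_ofNat_re]

omit [NumberField K] in
/-- `Re Γ_ℂ'/Γ_ℂ(σ) = −log 2π + ψ(σ)` for real `σ > 0` (the gamma-factor terms of the displayed
identity in the proof of Prop. 7.32). [cite: Bordelles2020ArithmeticTales, Prop. 7.32 (proof)] -/
theorem re_logDeriv_Gammaℂ_ofReal {σ : ℝ} (hσ : 0 < σ) :
    (logDeriv Gammaℂ σ).re = -Real.log (2 * Real.pi) + (digamma (σ : ℂ)).re := by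
  rw [logDeriv_Gammaℂ (ne_neg_nat_of_re_pos (by simpa using hσ)),
    show (2 : ℂ) * (Real.pi : ℂ) = ((2 * Real.pi : ℝ) : ℂ) by push_cast; ring,
    add_re, neg_re, log_ofReal_re]

/-- **The logarithmic derivative of `ξ_K` on the real axis** (the displayed identity in the proof of
[Bordelles2020ArithmeticTales, Prop. 7.32], left-hand side): for `σ > 1`,
`Re ξ_K'/ξ_K(σ) = 1/σ + 1/(σ−1) − L(Λ_K,σ) + ½log|d_K| + r₁(−½log π + ½ψ(σ/2)) + r₂(−log 2π + ψ(σ))`,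
where `ξ_K(s) = s ζ₁_K(s) γ_K(s)` on `Re s > 0` (`exists_starkXi`).
[cite: Bordelles2020ArithmeticTales, Prop. 7.32 (proof)] -/
theorem re_logDeriv_xi_eq {ξ : ℂ → ℂ}
    (hpos : ∀ s : ℂ, 0 < s.re → ξ s = s * dedekindZeta₁ K s * dedekindGammaFactor K s)
    {σ : ℝ} (hσ1 : 1 < σ) :
    (logDeriv ξ σ).re =
      1 / σ + (1 / (σ - 1) - (LSeries (fun n ↦ (vonMangoldtNorm K n : ℂ)) σ).re) +
        (Real.log ((discr K).natAbs : ℝ) / 2 +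
          (nrRealPlaces K : ℝ) * (-Real.log Real.pi / 2 + (digamma ((σ : ℂ) / 2)).re / 2) +
          (nrComplexPlaces K : ℝ) * (-Real.log (2 * Real.pi) + (digamma (σ : ℂ)).re)) := by
  have hσ0 : 0 < (σ : ℂ).re := by simp; linarith
  have hopen : IsOpen {z : ℂ | 0 < z.re} := isOpen_lt continuous_const continuous_re
  have hev : ξ =ᶠ[𝓝 (σ : ℂ)] fun s ↦ s * dedekindZeta₁ K s * dedekindGammaFactor K s := by
    filter_upwards [hopen.mem_nhds hσ0] with z hz using hpos z hz
  have hlog : logDeriv ξ σ =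
      logDeriv (fun s ↦ s * dedekindZeta₁ K s * dedekindGammaFactor K s) σ := by
    rw [logDeriv_apply, logDeriv_apply, hev.deriv_eq, hev.self_of_nhds]
  have hσne0 : (σ : ℂ) ≠ 0 := by
    intro h; rw [h, zero_re] at hσ0; exact lt_irrefl _ hσ0
  have hζ : dedekindZeta₁ K σ ≠ 0 := dedekindZeta₁_ne_zero_of_one_le_re (by simp; linarith)
  have hγ : dedekindGammaFactor K σ ≠ 0 := dedekindGammaFactor_ne_zero_of_re_pos hσ0
  have hdζ : DifferentiableAt ℂ (dedekindZeta₁ K) σ := dedekindZeta₁_differentiable K _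
  have hdγ : DifferentiableAt ℂ (dedekindGammaFactor K) σ :=
    differentiableAt_dedekindGammaFactor (ne_neg_nat_of_re_pos hσ0)
  rw [hlog, logDeriv_mul (f := fun s ↦ s * dedekindZeta₁ K s) (g := dedekindGammaFactor K) (σ : ℂ)
      (mul_ne_zero hσne0 hζ) hγ (differentiableAt_id.mul hdζ) hdγ,
    logDeriv_mul (f := fun s : ℂ ↦ s) (g := dedekindZeta₁ K) (σ : ℂ) hσne0 hζ differentiableAt_id hdζ]
  have hid : logDeriv (fun s : ℂ ↦ s) σ = ((1 / σ : ℝ) : ℂ) := by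
    rw [logDeriv_apply, deriv_id'']
    push_cast
    ring
  have hz : (logDeriv (dedekindZeta₁ K) σ).re =
      1 / (σ - 1) - (LSeries (fun n ↦ (vonMangoldtNorm K n : ℂ)) σ).re := by
    rw [logDeriv_dedekindZeta₁_eq (K := K) (by simpa using hσ1), sub_re,
      show (1 : ℂ) / ((σ : ℂ) - 1) = ((1 / (σ - 1) : ℝ) : ℂ) by push_cast; ring, ofReal_re]
  rw [add_re, add_re, hid, ofReal_re, hz, re_logDeriv_dedekindGammaFactor_ofReal (K := K) (by linarith),
    re_logDeriv_Gammaℝ_ofReal (by linarith), re_logDeriv_Gammaℂ_ofReal (by linarith)]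

/-! ## §3 Stark's inequality: the discriminant against the gamma factors, primes and zeros -/

variable (K) in
/-- **Stark's discriminant inequality with the prime and zero terms kept** (the displayed identity
in the proof of [Bordelles2020ArithmeticTales, Prop. 7.32]:
`log|d_K| = r₁(log π − ψ(σ/2)) + 2r₂(log 2π − ψ(σ)) − 2/σ − 2/(σ−1) + Σ_ρ(1/(σ−ρ) + 1/(σ−ρ̄)) − 2ζ_K'/ζ_K(σ)`,
all terms of the zero sum being positive): for real `σ > 1` and every finite multiset `S` of zeros
of `ζ_K` in `Re s > 0` counted at most with multiplicity (`S.count z ≤ ord_z ζ₁_K`),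
`r₁(log π − ψ(σ/2)) + 2r₂(log 2π − ψ(σ)) − 2/σ − 2/(σ−1) + 2·L(Λ_K,σ) + 2Σ_{ρ∈S} Re 1/(σ−ρ) ≤ log|d_K|`,
where `L(Λ_K,σ) = Σ_𝔞 Λ(𝔞)N𝔞^{−σ} = −ζ_K'/ζ_K(σ)`.
[cite: Bordelles2020ArithmeticTales, Prop. 7.32 (proof)] [cite: Stark1974, §2] -/
theorem log_absdiscr_ge_of_zeros {σ : ℝ} (hσ : 1 < σ) (S : Multiset ℂ)
    (hS0 : ∀ ρ ∈ S, 0 < ρ.re)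
    (hS : ∀ z, (S.count z : ℕ∞) ≤ analyticOrderAt (dedekindZeta₁ K) z) :
    (nrRealPlaces K : ℝ) * (Real.log Real.pi - (digamma ((σ : ℂ) / 2)).re) +
        2 * (nrComplexPlaces K : ℝ) * (Real.log (2 * Real.pi) - (digamma (σ : ℂ)).re) -
        2 / σ - 2 / (σ - 1) + 2 * (LSeries (fun n ↦ (vonMangoldtNorm K n : ℂ)) σ).re +
        2 * (S.map fun ρ ↦ (((σ : ℂ) - ρ)⁻¹).re).sum ≤ Real.log ((discr K).natAbs : ℝ) := by
  obtain ⟨ξ, hdiff, hsymm, ⟨C, hC⟩, hpos⟩ := exists_starkXi K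
  have hzero : ∀ s, ξ s = 0 → s.re ≤ 1 := fun s hs ↦ (xi_zero hsymm hpos hs).2.1.le
  have hSξ : ∀ z, (S.count z : ℕ∞) ≤ analyticOrderAt ξ z := by
    intro z
    by_cases hz : z ∈ S
    · rw [analyticOrderAt_xi_eq hpos (hS0 z hz)]
      exact hS z
    · rw [Multiset.count_eq_zero_of_notMem hz]
      simp
  have hsum := Stark1974.multiset_sum_re_inv_sub_le_re_logDeriv hdiff hsymm
    (by norm_num : (15 / 8 : ℝ) < 2) (by norm_num) hC hzero S hSξ hσ
  rw [re_logDeriv_xi_eq hpos hσ] at hsum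
  have e3 : (2 : ℝ) / σ = 2 * (1 / σ) := by ring
  have e4 : (2 : ℝ) / (σ - 1) = 2 * (1 / (σ - 1)) := by ring
  have e5 : (nrRealPlaces K : ℝ) * (Real.log Real.pi - (digamma ((σ : ℂ) / 2)).re) =
      -2 * ((nrRealPlaces K : ℝ) * (-Real.log Real.pi / 2 + (digamma ((σ : ℂ) / 2)).re / 2)) := by
    ring
  linarith

variable (K) in
/-- **Stark's analytic lower bound for the discriminant** ([Bordelles2020ArithmeticTales, Prop. 7.32];
Stark 1975): for every number field `K` with signature `(r₁, r₂)` and every real `σ > 1`,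
`log|d_K| ≥ r₁(log π − ψ(σ/2)) + 2r₂(log 2π − ψ(σ)) − 2/σ − 2/(σ−1)`.
[cite: Bordelles2020ArithmeticTales, Prop. 7.32] [cite: Stark1975] -/
theorem log_absdiscr_ge_stark {σ : ℝ} (hσ : 1 < σ) :
    (nrRealPlaces K : ℝ) * (Real.log Real.pi - (digamma ((σ : ℂ) / 2)).re) +
        2 * (nrComplexPlaces K : ℝ) * (Real.log (2 * Real.pi) - (digamma (σ : ℂ)).re) -
        2 / σ - 2 / (σ - 1) ≤ Real.log ((discr K).natAbs : ℝ) := by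
  have h := log_absdiscr_ge_of_zeros K hσ 0 (by simp) (by simp)
  have hL := re_LSeries_vonMangoldtNorm_nonneg (K := K) hσ
  simp only [Multiset.map_zero, Multiset.sum_zero, mul_zero, add_zero] at h
  linarith

variable (K) in
/-- **With the prime sum kept** (same source): for `σ > 1`,
`r₁(log π − ψ(σ/2)) + 2r₂(log 2π − ψ(σ)) − 2/σ − 2/(σ−1) + 2Σ_𝔞 Λ(𝔞)N𝔞^{−σ} ≤ log|d_K|` — many prime
ideals of small norm force a larger discriminant. [cite: Bordelles2020ArithmeticTales, Prop. 7.32 (proof)] -/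
theorem log_absdiscr_ge_stark_primes {σ : ℝ} (hσ : 1 < σ) :
    (nrRealPlaces K : ℝ) * (Real.log Real.pi - (digamma ((σ : ℂ) / 2)).re) +
        2 * (nrComplexPlaces K : ℝ) * (Real.log (2 * Real.pi) - (digamma (σ : ℂ)).re) -
        2 / σ - 2 / (σ - 1) + 2 * (LSeries (fun n ↦ (vonMangoldtNorm K n : ℂ)) σ).re ≤
      Real.log ((discr K).natAbs : ℝ) := by
  have h := log_absdiscr_ge_of_zeros K hσ 0 (by simp) (by simp)
  simp only [Multiset.map_zero, Multiset.sum_zero, mul_zero, add_zero] at h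
  exact h

variable (K) in
/-- **Tangent-line form** of Stark's bound at `σ = 1 + h`, `h > 0`:
`log|d_K| ≥ r₁(log 4π + γ − (π²/4)h) + 2r₂(log 2π + γ − (π²/6)h) − 2/h − 2/(1+h)`
(Prop. 7.32 with `ψ((1+h)/2) ≤ ψ(½) + (π²/4)h`, `ψ(1+h) ≤ ψ(1) + (π²/6)h`,
`ψ(½) = −γ − 2log 2`, `ψ(1) = −γ`). [cite: Bordelles2020ArithmeticTales, Prop. 7.32 / Cor. 7.9 (proof)] -/
theorem log_absdiscr_ge_linear {h : ℝ} (hh : 0 < h) :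
    (nrRealPlaces K : ℝ) * (Real.log (4 * Real.pi) + Real.eulerMascheroniConstant - Real.pi ^ 2 / 4 * h) +
        2 * (nrComplexPlaces K : ℝ) *
          (Real.log (2 * Real.pi) + Real.eulerMascheroniConstant - Real.pi ^ 2 / 6 * h) -
        2 / h - 2 / (1 + h) ≤ Real.log ((discr K).natAbs : ℝ) := by
  have hmain := log_absdiscr_ge_stark K (σ := 1 + h) (by linarith)
  have hψ1 := re_digamma_half_add_le hh.le
  have hψ2 := re_digamma_one_add_le hh.le
  have hcast1 : (((1 + h : ℝ)) : ℂ) / 2 = ((((1 + h) / 2 : ℝ)) : ℂ) := by push_cast; ring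
  rw [hcast1] at hmain
  have h4π : Real.log (4 * Real.pi) = 2 * Real.log 2 + Real.log Real.pi := by
    rw [Real.log_mul (by norm_num) Real.pi_ne_zero, show (4 : ℝ) = 2 ^ 2 by norm_num, Real.log_pow]
    push_cast
    ring
  have hr1 : (0 : ℝ) ≤ nrRealPlaces K := Nat.cast_nonneg _
  have hr2 : (0 : ℝ) ≤ nrComplexPlaces K := Nat.cast_nonneg _
  have e1 := mul_le_mul_of_nonneg_left hψ1 hr1
  have e2 := mul_le_mul_of_nonneg_left hψ2 hr2
  rw [show (1 + h) - 1 = h by ring] at hmain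
  rw [h4π]
  nlinarith [e1, e2, hmain]

/-! ## §4 Consequences: `|d_K| > e^{−8}(2π)^n`, and `|d_K| > (2π)^n` for `n ≥ 50` -/

/-- Numerical step: `π² ≤ 6 s log 2` whenever `s > 0` and `s² ≥ 2π²/3`
(so that `h = 2/s` satisfies `(π²/12)h ≤ log 2`). [folklore] -/
private theorem pi_sq_le_six_mul_log_two {s : ℝ} (hs : 0 < s) (hs2 : 2 * Real.pi ^ 2 / 3 ≤ s ^ 2) :
    Real.pi ^ 2 ≤ 6 * s * Real.log 2 := by
  have hlog2 := Real.log_two_gt_d9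
  have hπ := Real.pi_lt_d2
  have hπ0 := Real.pi_pos
  have hl0 : 0 < Real.log 2 := by linarith
  by_contra hlt
  push Not at hlt
  -- `6 s log 2 < π²` ⇒ `36 s² (log 2)² < π⁴`; but `36 s² (log 2)² ≥ 24 π² (log 2)² > 11.5 π² > π⁴`
  have h1 : (6 * s * Real.log 2) ^ 2 < (Real.pi ^ 2) ^ 2 := by
    have h0 : 0 ≤ 6 * s * Real.log 2 := by positivity
    nlinarith
  have hl2 : 0.48 < Real.log 2 ^ 2 := by nlinarith
  have hπ2 : Real.pi ^ 2 < 9.93 := by nlinarith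
  have hA : (6 * s * Real.log 2) ^ 2 = 36 * s ^ 2 * Real.log 2 ^ 2 := by ring
  have hB : 24 * Real.pi ^ 2 * 0.48 ≤ 36 * s ^ 2 * Real.log 2 ^ 2 := by
    have := mul_le_mul hs2 hl2.le (by norm_num) (by positivity)
    nlinarith
  have hC : (Real.pi ^ 2) ^ 2 < 9.93 * Real.pi ^ 2 := by nlinarith
  nlinarith

variable (K) in
/-- **Degree form** ([Bordelles2020ArithmeticTales, Cor. 7.9, proof]): for every number field `K`
of degree `n ≥ 2`, `log|d_K| ≥ n(log 2π + γ) − 2√(π²n/3) − 2`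
(the tangent-line form at `h = 2/s`, `s = √(π²n/3)`, after absorbing the real places:
`log 4π + γ − (π²/4)h ≥ log 2π + γ − (π²/6)h` as `(π²/12)h ≤ log 2`).
[cite: Bordelles2020ArithmeticTales, Cor. 7.9 (proof)] -/
theorem log_absdiscr_ge_degree (hn : 2 ≤ Module.finrank ℚ K) :
    (Module.finrank ℚ K : ℝ) * (Real.log (2 * Real.pi) + Real.eulerMascheroniConstant) -
        2 * Real.sqrt (Real.pi ^ 2 * Module.finrank ℚ K / 3) - 2 ≤
      Real.log ((discr K).natAbs : ℝ) := by
  set n : ℕ := Module.finrank ℚ K with hn_def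
  have hn2 : (2 : ℝ) ≤ n := by exact_mod_cast hn
  set s : ℝ := Real.sqrt (Real.pi ^ 2 * n / 3) with hs_def
  have hπ0 := Real.pi_pos
  have hs2 : s ^ 2 = Real.pi ^ 2 * n / 3 := by
    rw [hs_def, Real.sq_sqrt (by positivity)]
  have hs0 : 0 < s := by
    rw [hs_def]; exact Real.sqrt_pos.2 (by positivity)
  have hs2ge : 2 * Real.pi ^ 2 / 3 ≤ s ^ 2 := by rw [hs2]; nlinarith
  have habs := pi_sq_le_six_mul_log_two hs0 hs2ge
  -- `h = 2/s`
  have hh : 0 < 2 / s := by positivity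
  have hmain := log_absdiscr_ge_linear K hh
  have hrank : (nrRealPlaces K : ℝ) + 2 * nrComplexPlaces K = n := by
    rw [hn_def]; exact_mod_cast card_add_two_mul_card_eq_rank K
  have hr1 : (0 : ℝ) ≤ nrRealPlaces K := Nat.cast_nonneg _
  have hr2 : (0 : ℝ) ≤ nrComplexPlaces K := Nat.cast_nonneg _
  -- the two `h`-terms: `(π²/6)·(2/s)·n = s` and `2/(2/s) = s`; and `2/(1 + 2/s) ≤ 2`
  have ht1 : Real.pi ^ 2 / 6 * (2 / s) * n = s := by
    calc Real.pi ^ 2 / 6 * (2 / s) * n = (Real.pi ^ 2 * n / 3) / s := by ring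
      _ = s ^ 2 / s := by rw [← hs2]
      _ = s := by rw [sq, mul_div_cancel_right₀ _ hs0.ne']
  have ht2 : 2 / (2 / s) = s := by field_simp
  have ht3 : 2 / (1 + 2 / s) ≤ 2 := by
    rw [div_le_iff₀ (by positivity)]; nlinarith
  rw [ht2] at hmain
  -- absorbing the real places: `log 4π + γ − (π²/4)h ≥ log 2π + γ − (π²/6)h` as `π²/(6s) ≤ log 2`
  have h4π : Real.log (4 * Real.pi) = Real.log 2 + Real.log (2 * Real.pi) := by
    rw [show (4 : ℝ) * Real.pi = 2 * (2 * Real.pi) by ring,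
      Real.log_mul (by norm_num) (by positivity)]
  have hq : Real.pi ^ 2 / (6 * s) ≤ Real.log 2 := by
    rw [div_le_iff₀ (by positivity)]; linarith
  have hq' : Real.pi ^ 2 / 4 * (2 / s) - Real.pi ^ 2 / 6 * (2 / s) = Real.pi ^ 2 / (6 * s) := by
    field_simp; ring
  -- abbreviations
  set A2 : ℝ := Real.log (2 * Real.pi) + Real.eulerMascheroniConstant with hA2
  set B : ℝ := A2 - Real.pi ^ 2 / 6 * (2 / s) with hB
  set B' : ℝ := Real.log (4 * Real.pi) + Real.eulerMascheroniConstant - Real.pi ^ 2 / 4 * (2 / s)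
    with hB'
  have hreal : B ≤ B' := by
    simp only [hB, hB', hA2]
    linarith
  have e1 : (nrRealPlaces K : ℝ) * B ≤ (nrRealPlaces K : ℝ) * B' := mul_le_mul_of_nonneg_left hreal hr1
  have hnB : (n : ℝ) * B = (nrRealPlaces K : ℝ) * B + 2 * (nrComplexPlaces K : ℝ) * B := by
    rw [← hrank]; ring
  have hnB' : (n : ℝ) * B = n * A2 - s := by
    have : (n : ℝ) * B = n * A2 - Real.pi ^ 2 / 6 * (2 / s) * n := by simp only [hB]; ring
    rw [this, ht1]
  linarith [hmain, e1, hnB, hnB', ht3]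

variable (K) in
/-- **Bordellès, Cor. 7.9 (i)**: every number field of degree `n ≥ 2` has `|d_K| > e^{−8}(2π)^n`.
(From the degree form: `γn − 2√(π²n/3) − 2 > −8` for all `n`, as `γ > π²/18`.)
[cite: Bordelles2020ArithmeticTales, Cor. 7.9] -/
theorem exp_neg_eight_mul_two_pi_pow_lt_absdiscr (hn : 2 ≤ Module.finrank ℚ K) :
    Real.exp (-8) * (2 * Real.pi) ^ Module.finrank ℚ K < ((discr K).natAbs : ℝ) := by
  have hmain := log_absdiscr_ge_degree K hn
  set n : ℕ := Module.finrank ℚ K with hn_def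
  set s : ℝ := Real.sqrt (Real.pi ^ 2 * n / 3) with hs_def
  have hπ0 := Real.pi_pos
  have hπ4 := Real.pi_lt_d4
  have hγ := Literature.Analysis.SpecialFunctions.Real.eulerMascheroniConstant_gt_d8
  have hn0 : (0 : ℝ) ≤ n := Nat.cast_nonneg _
  have hs2 : s ^ 2 = Real.pi ^ 2 * n / 3 := by rw [hs_def, Real.sq_sqrt (by positivity)]
  have hs0 : 0 ≤ s := Real.sqrt_nonneg _
  -- `n ≥ 3s²/π² > 0.30396 s²`, so `γ n ≥ 0.17545 s²`, and `0.17545 s² − 2s + 6 > 0`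
  have hπ2 : Real.pi ^ 2 < 9.8697 := by nlinarith
  have hns : 0.30396 * s ^ 2 ≤ (n : ℝ) := by nlinarith
  have hγn : 0.17545 * s ^ 2 ≤ Real.eulerMascheroniConstant * n := by nlinarith
  have hkey : -8 < Real.eulerMascheroniConstant * n - 2 * s - 2 := by
    nlinarith [sq_nonneg (s - 5.6996)]
  have hd : 0 < ((discr K).natAbs : ℝ) := by
    exact_mod_cast Int.natAbs_pos.mpr (discr_ne_zero K)
  have hlog : Real.log (Real.exp (-8) * (2 * Real.pi) ^ n) < Real.log ((discr K).natAbs : ℝ) := by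
    rw [Real.log_mul (Real.exp_pos _).ne' (by positivity), Real.log_exp, Real.log_pow]
    nlinarith [hmain, hkey]
  exact (Real.log_lt_log_iff (by positivity) hd).1 hlog

variable (K) in
/-- **Bordellès, Cor. 7.9 (ii)**: every number field of degree `n ≥ 50` has `|d_K| > (2π)^n`.
[cite: Bordelles2020ArithmeticTales, Cor. 7.9] -/
theorem two_pi_pow_lt_absdiscr (hn : 50 ≤ Module.finrank ℚ K) :
    (2 * Real.pi) ^ Module.finrank ℚ K < ((discr K).natAbs : ℝ) := by
  have hmain := log_absdiscr_ge_degree K (le_trans (by norm_num) hn)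
  set n : ℕ := Module.finrank ℚ K with hn_def
  set s : ℝ := Real.sqrt (Real.pi ^ 2 * n / 3) with hs_def
  have hπ0 := Real.pi_pos
  have hπ4 := Real.pi_lt_d4
  have hπ3 := Real.pi_gt_d6
  have hγ := Literature.Analysis.SpecialFunctions.Real.eulerMascheroniConstant_gt_d8
  have hn50 : (50 : ℝ) ≤ n := by exact_mod_cast hn
  have hs2 : s ^ 2 = Real.pi ^ 2 * n / 3 := by rw [hs_def, Real.sq_sqrt (by positivity)]
  have hs0 : 0 ≤ s := Real.sqrt_nonneg _
  have hπ2 : Real.pi ^ 2 < 9.8697 := by nlinarith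
  have hπ2' : 9.8695 < Real.pi ^ 2 := by nlinarith
  have hn0 : (0 : ℝ) ≤ n := Nat.cast_nonneg _
  have hns : 0.30396 * s ^ 2 ≤ (n : ℝ) := by nlinarith
  have hγn : 0.17545 * s ^ 2 ≤ Real.eulerMascheroniConstant * n := by nlinarith
  have hs2ge : 164.49 ≤ s ^ 2 := by rw [hs2]; nlinarith
  have hsge : 12.825 ≤ s := by nlinarith
  have hkey : 0 < Real.eulerMascheroniConstant * n - 2 * s - 2 := by nlinarith
  have hd : 0 < ((discr K).natAbs : ℝ) := by
    exact_mod_cast Int.natAbs_pos.mpr (discr_ne_zero K)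
  have hlog : Real.log ((2 * Real.pi) ^ n) < Real.log ((discr K).natAbs : ℝ) := by
    rw [Real.log_pow]
    nlinarith [hmain, hkey]
  exact (Real.log_lt_log_iff (by positivity) hd).1 hlog

variable (K) in
/-- The same two bounds with `|d_K|` as the absolute value of the integer `discr K`.
[cite: Bordelles2020ArithmeticTales, Cor. 7.9] -/
theorem two_pi_pow_lt_abs_discr :
    (2 ≤ Module.finrank ℚ K → Real.exp (-8) * (2 * Real.pi) ^ Module.finrank ℚ K < |(discr K : ℝ)|) ∧
      (50 ≤ Module.finrank ℚ K → (2 * Real.pi) ^ Module.finrank ℚ K < |(discr K : ℝ)|) := by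
  have hcast : (((discr K).natAbs : ℝ)) = |(discr K : ℝ)| := by
    rw [Nat.cast_natAbs, Int.cast_abs]
  exact ⟨fun h ↦ hcast ▸ exp_neg_eight_mul_two_pi_pow_lt_absdiscr K h,
    fun h ↦ hcast ▸ two_pi_pow_lt_absdiscr K h⟩

end Literature.NumberTheory.LFunctions.NumberField

end
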